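import Mathlib.RingTheory.RegularLocalRing.Defs
import Summits.ResolutionOfSingularities.ResolutionOfSingularities.Theorems.FrobeniusLadderFInjectiveMacaulayficationFedderClosure
import Summits.ResolutionOfSingularities.ResolutionOfSingularities.Theorems.FrobeniusLadderFInjectiveMacaulayficationDeformation
import Summits.ResolutionOfSingularities.ResolutionOfSingularities.Theorems.FrobeniusLadderFInjectiveMacaulayficationRetractDescent

/-!
# Line `Sketch`, lead seat c2 — the ideators' first lemmas are now THEOREMS

Crux stmt-ResolutionOfSingularities-15315 (`FrobeniusLadder.FInjectiveMacaulayfication`). The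
crux-ideate round-1 sketches filed five "first lemmas" as sorried signatures / `Prop` definitions:

* ideator 1 (`SketchIdeator1`, cards `graded-cartier-criterion`, `weakly-normal-centres`,
  `cartier-contraction-centres`): `stub_propagation`, `stub_pigeonhole`, `stub_trapped_image`,
  `stub_parameter_blowup_not_frobenius_closed`, `stub_frobenius_closed_principal_gives_pth_root_closed`
  — all LANDED by the leads `…-15315-0` / `…-15315-c1` (p129003, p129173, p129727, p129192); the two
  `cartier-contraction-centres` one-liners (`stub_contraction_refines`, `stub_contraction_top_of_witness`)
  are instances of `stub_propagation`-style `p⁻¹`-linearity and were not registered.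
* ideator 2 (`SketchIdeator2`, cards `fedder-embedded-f-purification`,
  `weighted-cone-deformation-descent`): the `Prop`s `FedderHypersurfaceCMFI`, `DeformationCMFI`,
  `SplitDescentFrobClosed` — DISCHARGED BELOW, sorry-free, from the three certification engines landed
  this cycle as supports of the crux:
  E2 `Theorems.FInjectiveMacaulayfication.Fedder.fedder_hypersurface_clause` (p132322),
  E1 `Theorems.FInjectiveMacaulayfication.Deformation.cmfi_of_cmfi_quotient` (p132502),
  E3 `Theorems.FInjectiveMacaulayfication.Retract.frobeniusClosed_of_retract` (p132333).

Consequence for crux-plan: every TYPABLE first lemma of all five round-1 cards is closed. What no card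
has typed (and what `stub_fInjectivize` = the crux modulo Kawasaki, p130409, still asks for) is the
ENGINE itself — a modification whose new local rings are certified by E1/E2/E3 — together with a
termination measure; the design constraints any engine must meet are landed too (parameter centres
never work: p131210 + p131741; CM ⇏ F-injective: p129375). Note that `FedderHypersurfaceCMFI` holds
WITHOUT the F-finiteness detour its docstring anticipated (Kunz's flat colon suffices), and that
`DeformationCMFI` needs no domain / excellence hypothesis.
-/

-- single-problem summit: the doubled namespace component is forced
set_option linter.dupNamespace false

namespace Summit.ResolutionOfSingularities.ResolutionOfSingularities.Cruxes.FInjectiveMacaulayfication.SketchEngines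

open Literature.RingTheory.TightClosure
open Summit.ResolutionOfSingularities.ResolutionOfSingularities.Theorems.FInjectiveMacaulayfication

/-! ## Ideator 2's definitions, VERBATIM from `Cruxes/FInjectiveMacaulayfication/SketchIdeator2.lean`
(namespace `…Cruxes.FInjectiveMacaulayfication.Ideator2`; copied here only because crux workfiles are not
built as importable modules on the farm — this file is a workfile, nothing here is proposed to the tree) -/

/-- [Ideator2, verbatim] The crux's stalk predicate for an abstract commutative ring `S` of characteristic `p`. -/
def CMFI (p : ℕ) (S : Type) [CommRing S] : Prop :=
  ∀ d : ℕ, ringKrullDim S = d → ∀ s : Fin d → S, (Ideal.span (Set.range s)).radical.IsMaximal →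
    RingTheory.Sequence.IsWeaklyRegular S (List.ofFn s) ∧
    ∀ y : S, (∃ e : ℕ, y ^ p ^ e ∈
        Ideal.span ((fun z : S => z ^ p ^ e) '' (Ideal.span (Set.range s) : Set S))) →
      y ∈ Ideal.span (Set.range s)

/-- [Ideator2, verbatim] Frobenius bracket power `I^[p]`. -/
def frobPow (p : ℕ) {S : Type} [CommRing S] (I : Ideal S) : Ideal S :=
  Ideal.span ((fun z : S => z ^ p) '' (I : Set S))

/-- [Ideator2, verbatim] First lemma of card `fedder-embedded-f-purification`. -/
def FedderHypersurfaceCMFI : Prop :=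
  ∀ p : ℕ, p.Prime → ∀ (R : Type) [CommRing R] [IsLocalRing R] [IsNoetherianRing R] [CharP R p],
    IsRegularLocalRing R → ∀ f : R, f ∈ IsLocalRing.maximalIdeal R → f ≠ 0 →
      f ^ (p - 1) ∉ frobPow p (IsLocalRing.maximalIdeal R) →
      CMFI p (R ⧸ Ideal.span ({f} : Set R))

/-- [Ideator2, verbatim] First lemma of card `weighted-cone-deformation-descent`. -/
def DeformationCMFI : Prop :=
  ∀ p : ℕ, p.Prime → ∀ (R : Type) [CommRing R] [IsLocalRing R] [IsNoetherianRing R] [CharP R p],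
    ∀ x : R, x ∈ IsLocalRing.maximalIdeal R → x ∈ nonZeroDivisors R →
      CMFI p (R ⧸ Ideal.span ({x} : Set R)) → CMFI p R

/-- [Ideator2, verbatim] Second lemma of card `weighted-cone-deformation-descent`. -/
def SplitDescentFrobClosed : Prop :=
  ∀ p : ℕ, p.Prime → ∀ (A B : Type) [CommRing A] [CommRing B] [CharP A p] [CharP B p]
    (i : A →+* B) (r : B → A), (∀ a : A, r (i a) = a) → (∀ (a : A) (b : B), r (i a * b) = a * r b) →
    (∀ b b' : B, r (b + b') = r b + r b') →
    ∀ I : Ideal A,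
      (∀ y : B, (∃ e : ℕ, y ^ p ^ e ∈
          Ideal.span ((fun z : B => z ^ p ^ e) '' (I.map i : Set B))) → y ∈ I.map i) →
      ∀ y : A, (∃ e : ℕ, y ^ p ^ e ∈ Ideal.span ((fun z : A => z ^ p ^ e) '' (I : Set A))) → y ∈ I

/-! ## Discharges -/

/-- Ideator 2's `DeformationCMFI` (card `weighted-cone-deformation-descent`, stub 1(i)) holds: it is
E1 `Deformation.cmfi_of_cmfi_quotient` verbatim. [cite: Fedder1983, Thm. 3.4 (1)] -/
theorem deformationCMFI_holds : DeformationCMFI := by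
  intro p hp R _ _ _ _ x hxm hx0 hquot
  haveI : Fact p.Prime := ⟨hp⟩
  exact Deformation.cmfi_of_cmfi_quotient p R x hxm hx0 hquot

/-- Ideator 2's `FedderHypersurfaceCMFI` (card `fedder-embedded-f-purification`, first lemma) holds:
E2 `Fedder.fedder_hypersurface_clause` gives even more (EVERY ideal of `R/(f)` Frobenius closed, not
only parameter ideals), with no F-finiteness and without using `f ≠ 0`. [cite: Fedder1983, Prop. 1.7,
Thm. 1.12] -/
theorem fedderHypersurfaceCMFI_holds : FedderHypersurfaceCMFI := by
  intro p hp R _ _ _ _ hreg f hfm _ hf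
  haveI : Fact p.Prime := ⟨hp⟩
  haveI := hreg
  obtain ⟨hF, hCM⟩ := Fedder.fedder_hypersurface_clause p R f hfm hf
  intro d hd s hs
  exact ⟨hCM d hd s hs, fun y hy => hF _ y hy⟩

/-- Ideator 2's `SplitDescentFrobClosed` (card `weighted-cone-deformation-descent`, elementwise half of
degree-zero descent) holds: package the retraction `r` as an `A`-linear map for the algebra structure
induced by `i` and apply E3 `Retract.frobeniusClosed_of_retract`. [folklore] -/
theorem splitDescentFrobClosed_holds : SplitDescentFrobClosed := by
  intro p hp A B _ _ _ _ i r hri hlin hadd I hIB y hy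
  haveI : Fact p.Prime := ⟨hp⟩
  letI : Algebra A B := i.toAlgebra
  let ρ : B →ₗ[A] A :=
    { toFun := r
      map_add' := hadd
      map_smul' := fun a b => by
        rw [RingHom.id_apply, Algebra.smul_def, smul_eq_mul]
        exact hlin a b }
  have hρ1 : ρ 1 = 1 := by
    show r 1 = 1
    have h := hri 1
    rwa [map_one] at h
  have hmap : I.map (algebraMap A B) = I.map i := rfl
  have hIB' : IsFrobeniusClosed p (I.map (algebraMap A B)) := by
    rw [hmap]
    exact (isFrobeniusClosed_iff p).mpr hIB
  exact (isFrobeniusClosed_iff p).mp (Retract.frobeniusClosed_of_retract p A B ρ hρ1 I hIB') y hy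

end Summit.ResolutionOfSingularities.ResolutionOfSingularities.Cruxes.FInjectiveMacaulayfication.SketchEngines
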